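import Literature.Combinatorics.Additive.EntropicRuzsaDistance
import HarnessLib

/-!
# Zero entropic Ruzsa distance: the `100%` inverse theorem (Gowers–Green–Manners–Tao, Lemma 2.2)

Topic `Literature/Combinatorics/Additive`. Everything in this file is PROVED.

* `EntropicRuzsa.eq_of_sum_mul_log_div_nonpos` — Gibbs' inequality with equality on a finite
  set (`∑ p log (p/q) ≤ 0`, equal masses `⇒ p = q`), from `log x ≤ x - 1` with equality iff
  `x = 1` (Mathlib `Real.log_lt_sub_one_of_pos`);
* `EntropicRuzsa.mutualInfo_eq_sum_mul_log` (`I[X : Y]` as a Kullback–Leibler sum) and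
  `EntropicRuzsa.indepRV_of_mutualInfo_eq_zero` (the equality case of `I ≥ 0`, GGMT (A.4));
* `EntropicRuzsa.exists_subgroup_rdist_uniform_eq_zero` — if `d[μ ; μ] = 0` then `μ` is uniform
  on a coset of a subgroup `H` and `d[μ ; U_H] = 0` (the result of Tao quoted in GGMT Lemma 2.2:
  `H[X + X'] = H[X]` for an independent copy `X'` forces `X + X' ⊥ X'`, so `μ` is invariant under
  translation by `supp μ - supp μ`; `H` is the stabiliser `{h : μ(· + h) = μ}`);
* `EntropicRuzsa.exists_subgroup_of_dLaw_eq_zero` — **GGMT Lemma 2.2**: `d[μ₁ ; μ₂] = 0 ⇒`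
  there is a subgroup `H` with `d[μ₁ ; U_H] = d[μ₂ ; U_H] = 0` (triangle inequality).

The uniform distribution `U_H` is realised as the identity random variable on a finite set
`T` with `x ∈ T ↔ x ∈ H` and unit weights.

## References
* W. T. Gowers, B. Green, F. Manners, T. Tao, *On a conjecture of Marton*, Ann. of Math. (2)
  201 (2025), Lemma 2.2.
* T. Tao, *Sumset and inverse sumset theory for Shannon entropy*, CPC 19 (2010).
-/

open Finset Real Literature.Probability.Entropy.FiniteShannon

noncomputable section

namespace Literature.Combinatorics.Additive

namespace EntropicRuzsa

/-! ### Gibbs' inequality with equality; independence from vanishing mutual information -/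

section Gibbs

variable {κ : Type*}

/-- **Gibbs' inequality, equality case** (finite form): if `p ≥ 0`, `q > 0` on `T` have the
same total mass and `∑_T p log (p / q) ≤ 0`, then `p = q` on `T`. [folklore] -/
theorem eq_of_sum_mul_log_div_nonpos {T : Finset κ} {p q : κ → ℝ} (hp : ∀ i ∈ T, 0 ≤ p i)
    (hq : ∀ i ∈ T, 0 < q i) (hpq : ∑ i ∈ T, p i = ∑ i ∈ T, q i)
    (h : ∑ i ∈ T, p i * Real.log (p i / q i) ≤ 0) : ∀ i ∈ T, p i = q i := by
  -- each term `p log (p/q) - (p - q)` is nonnegative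
  have key : ∀ i ∈ T, 0 < p i →
      p i * Real.log (p i / q i) = -(p i * (Real.log (q i) - Real.log (p i))) := by
    intro i hi hpos
    rw [Real.log_div hpos.ne' (hq i hi).ne']; ring
  have hf : ∀ i ∈ T, 0 ≤ p i * Real.log (p i / q i) - (p i - q i) := by
    intro i hi
    rcases (hp i hi).eq_or_lt with h0 | hpos
    · rw [← h0]; simp [(hq i hi).le]
    · have hx : 0 < q i / p i := div_pos (hq i hi) hpos
      have h1 := Real.log_le_sub_one_of_pos hx
      rw [Real.log_div (hq i hi).ne' hpos.ne'] at h1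
      have h3 : p i * (Real.log (q i) - Real.log (p i)) ≤ p i * (q i / p i - 1) :=
        mul_le_mul_of_nonneg_left h1 hpos.le
      have h4 : p i * (q i / p i - 1) = q i - p i := by field_simp
      rw [key i hi hpos]
      linarith
  have hsum : ∑ i ∈ T, (p i * Real.log (p i / q i) - (p i - q i)) =
      ∑ i ∈ T, p i * Real.log (p i / q i) := by
    rw [sum_sub_distrib, sum_sub_distrib, hpq, sub_self, sub_zero]
  have hall := (sum_eq_zero_iff_of_nonneg hf).1
    (le_antisymm (by rw [hsum]; exact h) (sum_nonneg hf))
  intro i hi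
  have h0 := hall i hi
  rcases (hp i hi).eq_or_lt with hp0 | hpos
  · exfalso
    rw [← hp0] at h0
    simp only [zero_mul, zero_sub, sub_neg_eq_add, zero_add] at h0
    exact (hq i hi).ne' h0
  · by_contra hne
    have hx : 0 < q i / p i := div_pos (hq i hi) hpos
    have hx1 : q i / p i ≠ 1 := by
      intro h1
      rw [div_eq_one_iff_eq hpos.ne'] at h1
      exact hne h1.symm
    have hlt := Real.log_lt_sub_one_of_pos hx hx1
    rw [Real.log_div (hq i hi).ne' hpos.ne'] at hlt
    have h3 : p i * (Real.log (q i) - Real.log (p i)) < p i * (q i / p i - 1) :=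
      mul_lt_mul_of_pos_left hlt hpos
    have h4 : p i * (q i / p i - 1) = q i - p i := by field_simp
    rw [key i hi hpos] at h0
    linarith

variable {ι α β : Type*} [DecidableEq α] [DecidableEq β] {s : Finset ι} {w : ι → ℝ} {X : ι → α}
  {Y : ι → β}

/-- The mutual information as a Kullback–Leibler divergence:
`I[X : Y] = ∑_{a,b} P(a,b) log (P(a,b) / (P(a) P(b)))`. [folklore] -/
theorem mutualInfo_eq_sum_mul_log (hw : ∀ i ∈ s, 0 ≤ w i) :
    mutualInfo s w X Y = ∑ p ∈ s.image X ×ˢ s.image Y,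
      prob s w (fun i => (X i, Y i)) p *
        Real.log (prob s w (fun i => (X i, Y i)) p / (prob s w X p.1 * prob s w Y p.2)) := by
  have eX : ent s w X = ∑ p ∈ s.image X ×ˢ s.image Y,
      -(prob s w (fun i => (X i, Y i)) p * Real.log (prob s w X p.1)) := by
    rw [ent_def, sum_product]
    refine sum_congr rfl fun a _ => ?_
    have hm : prob s w X a = ∑ b ∈ s.image Y, prob s w (fun i => (X i, Y i)) (a, b) :=
      prob_eq_sum_prob_pair_left subset_rfl a
    dsimp only
    rw [sum_neg_distrib, ← sum_mul, ← hm, negMulLog, neg_mul]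
  have eY : ent s w Y = ∑ p ∈ s.image X ×ˢ s.image Y,
      -(prob s w (fun i => (X i, Y i)) p * Real.log (prob s w Y p.2)) := by
    rw [ent_def, sum_product_right]
    refine sum_congr rfl fun b _ => ?_
    have hm : prob s w Y b = ∑ a ∈ s.image X, prob s w (fun i => (X i, Y i)) (a, b) :=
      prob_eq_sum_prob_pair_right subset_rfl b
    dsimp only
    rw [sum_neg_distrib, ← sum_mul, ← hm, negMulLog, neg_mul]
  have eXY : ent s w (fun i => (X i, Y i)) = ∑ p ∈ s.image X ×ˢ s.image Y,
      -(prob s w (fun i => (X i, Y i)) p * Real.log (prob s w (fun i => (X i, Y i)) p)) := by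
    rw [ent_eq_sum_of_subset image_pair_subset_product]
    exact sum_congr rfl fun p _ => by rw [negMulLog, neg_mul]
  rw [mutualInfo_def, eX, eY, eXY, ← sum_add_distrib, ← sum_sub_distrib]
  refine sum_congr rfl fun p _ => ?_
  rcases (prob_nonneg hw p : 0 ≤ prob s w (fun i => (X i, Y i)) p).eq_or_lt with h0 | hpos
  · rw [← h0]; simp
  · -- the marginals are positive
    have hXp : 0 < prob s w X p.1 := by
      refine lt_of_lt_of_le hpos ?_
      rw [prob_eq_sum_prob_pair_left (X := X) (Y := Y) subset_rfl p.1]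
      rcases em (p.2 ∈ s.image Y) with h2 | h2
      · exact single_le_sum (f := fun b => prob s w (fun i => (X i, Y i)) (p.1, b))
          (fun b _ => prob_nonneg hw _) h2
      · rw [prob_pair_eq_zero_of_not_mem (Or.inr h2)] at hpos; exact absurd hpos (lt_irrefl 0)
    have hYp : 0 < prob s w Y p.2 := by
      refine lt_of_lt_of_le hpos ?_
      rw [prob_eq_sum_prob_pair_right (X := X) (Y := Y) subset_rfl p.2]
      rcases em (p.1 ∈ s.image X) with h1 | h1
      · exact single_le_sum (f := fun a => prob s w (fun i => (X i, Y i)) (a, p.2))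
          (fun a _ => prob_nonneg hw _) h1
      · rw [prob_pair_eq_zero_of_not_mem (Or.inl h1)] at hpos; exact absurd hpos (lt_irrefl 0)
    rw [Real.log_div hpos.ne' (mul_ne_zero hXp.ne' hYp.ne'), Real.log_mul hXp.ne' hYp.ne']
    ring

/-- **Vanishing mutual information implies independence** (the equality case of `I[X : Y] ≥ 0`;
GGMT (A.4)). [cite: GowersEtAl2025, (A.4)] -/
theorem indepRV_of_mutualInfo_eq_zero (hw : ∀ i ∈ s, 0 ≤ w i) (hs : 0 < mass s w)
    (h : mutualInfo s w X Y = 0) : IndepRV s w X Y := by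
  set P := prob s w (fun i => (X i, Y i)) with hP
  set R := s.image X ×ˢ s.image Y with hR
  set T := R.filter (fun p => 0 < prob s w X p.1 * prob s w Y p.2) with hT
  -- on the complement of `T` inside `R`, both sides vanish
  have hPle : ∀ p, P p ≤ prob s w X p.1 := by
    intro p
    rw [prob_eq_sum_prob_pair_left (X := X) (Y := Y) subset_rfl p.1]
    rcases em (p.2 ∈ s.image Y) with h2 | h2
    · exact single_le_sum (f := fun b => prob s w (fun i => (X i, Y i)) (p.1, b))
        (fun b _ => prob_nonneg hw _) h2
    · rw [hP, prob_pair_eq_zero_of_not_mem (Or.inr h2)]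
      exact sum_nonneg fun b _ => prob_nonneg hw _
  have hPle' : ∀ p, P p ≤ prob s w Y p.2 := by
    intro p
    rw [prob_eq_sum_prob_pair_right (X := X) (Y := Y) subset_rfl p.2]
    rcases em (p.1 ∈ s.image X) with h1 | h1
    · exact single_le_sum (f := fun a => prob s w (fun i => (X i, Y i)) (a, p.2))
        (fun a _ => prob_nonneg hw _) h1
    · rw [hP, prob_pair_eq_zero_of_not_mem (Or.inl h1)]
      exact sum_nonneg fun a _ => prob_nonneg hw _
  have hzero : ∀ p, ¬ 0 < prob s w X p.1 * prob s w Y p.2 → P p = 0 ∧ prob s w X p.1 * prob s w Y p.2 = 0 := by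
    intro p hp
    have h1 : prob s w X p.1 * prob s w Y p.2 = 0 := by
      have := mul_nonneg (prob_nonneg hw p.1 : 0 ≤ prob s w X p.1) (prob_nonneg hw p.2 : 0 ≤ prob s w Y p.2)
      exact le_antisymm (not_lt.1 hp) this
    refine ⟨?_, h1⟩
    rcases mul_eq_zero.1 h1 with h | h
    · exact le_antisymm (h ▸ hPle p) (prob_nonneg hw p)
    · exact le_antisymm (h ▸ hPle' p) (prob_nonneg hw p)
  -- Gibbs on `T`
  have hsumP : ∑ p ∈ T, P p = 1 := by
    have h1 : ∑ p ∈ R, P p = 1 := sum_prob_eq_one hs image_pair_subset_product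
    rw [← h1, hT, sum_filter]
    refine sum_congr rfl fun p _ => ?_
    split_ifs with hp
    · rfl
    · exact ((hzero p hp).1).symm
  have hsumQ : ∑ p ∈ T, prob s w X p.1 * prob s w Y p.2 = 1 := by
    have h1 : ∑ p ∈ R, prob s w X p.1 * prob s w Y p.2 = 1 := by
      rw [hR, sum_product, ← sum_mul_sum, sum_prob_eq_one hs subset_rfl,
        sum_prob_eq_one hs subset_rfl, one_mul]
    rw [← h1, hT, sum_filter]
    refine sum_congr rfl fun p _ => ?_
    split_ifs with hp
    · rfl
    · exact ((hzero p hp).2).symm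
  have hKL : ∑ p ∈ T, P p * Real.log (P p / (prob s w X p.1 * prob s w Y p.2)) ≤ 0 := by
    have h1 := mutualInfo_eq_sum_mul_log (X := X) (Y := Y) hw
    rw [h] at h1
    rw [hT, sum_filter]
    refine le_of_eq (Eq.trans (sum_congr rfl fun p _ => ?_) h1.symm)
    split_ifs with hp
    · rfl
    · rw [show prob s w (fun i => (X i, Y i)) p = P p from rfl, (hzero p hp).1, zero_mul]
  have hT' := eq_of_sum_mul_log_div_nonpos (fun p _ => prob_nonneg hw p)
    (fun p hp => (mem_filter.1 hp).2) (hsumP.trans hsumQ.symm) hKL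
  -- conclude
  intro a b
  by_cases hab : (a, b) ∈ R
  · by_cases hpos : 0 < prob s w X a * prob s w Y b
    · exact hT' (a, b) (mem_filter.2 ⟨hab, hpos⟩)
    · have := hzero (a, b) hpos
      rw [this.2]; exact this.1
  · rw [hR, mem_product, not_and_or] at hab
    rcases hab with ha | hb
    · rw [prob_pair_eq_zero_of_not_mem (Or.inl ha), prob_eq_zero_of_not_mem_image ha, zero_mul]
    · rw [prob_pair_eq_zero_of_not_mem (Or.inr hb), prob_eq_zero_of_not_mem_image hb, mul_zero]

end Gibbs

/-! ### Zero self-distance forces a coset of a subgroup (GGMT Lemma 2.2; Tao) -/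

section HundredPercent

variable {G : Type*} [AddCommGroup G] [Fintype G] [DecidableEq G] [Module (ZMod 2) G]

/-- **The `100%` inverse theorem for the entropic Ruzsa distance** (GGMT Lemma 2.2, from
[Tao, *Sumset and inverse sumset theory for Shannon entropy*, CPC 19 (2010)]; characteristic
two): if a law `μ` has `d[μ ; μ] = 0` then `μ` is uniform on a coset of a subgroup `H ≤ G`, and
consequently `d[μ ; U_H] = 0` for the uniform distribution `U_H` on `H` (realised as the identity
on the finite set `T = H` with unit weights). [cite: GowersEtAl2025, Lemma 2.2] -/
theorem exists_subgroup_rdist_uniform_eq_zero {μ : G → ℝ} (hμ : μ ∈ stdSimplex ℝ G)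
    (h : dLaw μ μ = 0) :
    ∃ (H : AddSubgroup G) (T : Finset G), (∀ x, x ∈ T ↔ x ∈ H) ∧
      rdist univ μ id T (fun _ => (1 : ℝ)) id = 0 := by
  classical
  -- Step 0: two independent copies `X = fst`, `X' = snd` on `Ω = G × G` with weights `μ ⊗ μ`
  set P : G × G → ℝ := prodW μ μ with hPdef
  have hμ0 := stdSimplex_nonneg hμ
  have hm1 := mass_univ_of_mem_stdSimplex hμ
  have hpos := mass_univ_pos_of_mem_stdSimplex hμ
  have hP : ∀ p ∈ (univ : Finset G) ×ˢ (univ : Finset G), 0 ≤ P p := prodW_nonneg hμ0 hμ0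
  have hmP : 0 < mass ((univ : Finset G) ×ˢ (univ : Finset G)) P := mass_prod_pos hpos hpos
  have lawX : ∀ a, prob (univ ×ˢ univ) P (fun p : G × G => p.1) a = μ a := fun a => by
    rw [hPdef, show (fun p : G × G => p.1) = fun p => id p.1 from rfl, prob_prod_fst id hpos.ne',
      prob_univ_id hμ.2]
  have lawX' : ∀ a, prob (univ ×ˢ univ) P (fun p : G × G => p.2) a = μ a := fun a => by
    rw [hPdef, show (fun p : G × G => p.2) = fun p => id p.2 from rfl, prob_prod_snd id hpos.ne',
      prob_univ_id hμ.2]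
  have hXX' : IndepRV (univ ×ˢ univ) P (fun p : G × G => p.1) (fun p : G × G => p.2) :=
    indepRV_prod (s := univ) (w := μ) (t := univ) (v := μ) id id
  have eX : ent (univ ×ˢ univ) P (fun p : G × G => p.1) = entFun μ := by
    rw [ent_eq_entFun, funext lawX]
  have eX' : ent (univ ×ˢ univ) P (fun p : G × G => p.2) = entFun μ := by
    rw [ent_eq_entFun, funext lawX']
  -- Step 1: `H[X + X'] = H[X]`
  have hsum : ent (univ ×ˢ univ) P (fun p : G × G => p.1 + p.2) = entFun μ := by
    have h1 := rdist_eq_ent_prod (s := univ) (w := μ) (t := univ) (v := μ) (id : G → G) id hpos hpos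
    rw [rdist_univ_id hμ, funext (prob_univ_id hμ.2), h, ent_eq_entFun univ μ id,
      funext (prob_univ_id hμ.2)] at h1
    rw [hPdef]
    have : (fun p : G × G => p.1 + p.2) = fun p => id p.1 + id p.2 := rfl
    rw [this]
    linarith
  -- Step 2: `I[X + X' : X'] = 0`, hence independence
  have hI : mutualInfo (univ ×ˢ univ) P (fun p : G × G => p.1 + p.2) (fun p : G × G => p.2) = 0 := by
    rw [mutualInfo_def, hsum, eX']
    have : ent (univ ×ˢ univ) P (fun p : G × G => (p.1 + p.2, p.2)) =
        ent (univ ×ˢ univ) P (fun p : G × G => (p.1, p.2)) := by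
      refine ent_eq_of_determines hP fun p _ q _ => ?_
      simp only [Prod.mk.injEq]
      constructor
      · rintro ⟨h1, h2⟩; exact ⟨by linear_combination (norm := abel) h1 - h2, h2⟩
      · rintro ⟨h1, h2⟩; exact ⟨by rw [h1, h2], h2⟩
    rw [this, hXX'.ent_pair_eq_add hmP, eX, eX']
    ring
  have hind := indepRV_of_mutualInfo_eq_zero hP hmP hI
  -- Step 3: translates of `μ` by points of the support coincide
  have hpair : ∀ z y, prob (univ ×ˢ univ) P (fun p : G × G => (p.1 + p.2, p.2)) (z, y) =
      μ (z + y) * μ y := by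
    intro z y
    rw [← lawX (z + y), ← lawX' y, ← hXX' (z + y) y, prob_def, prob_def]
    congr 2
    refine filter_congr fun p _ => ?_
    simp only [Prod.mk.injEq]
    constructor
    · rintro ⟨h1, h2⟩; exact ⟨by linear_combination (norm := abel) h1 - h2 - add_self_char2 y, h2⟩
    · rintro ⟨h1, h2⟩; exact ⟨by linear_combination (norm := abel) h1 + h2 + add_self_char2 y, h2⟩
  have htrans : ∀ y y', μ y ≠ 0 → μ y' ≠ 0 → ∀ z, μ (z + y) = μ (z + y') := by
    intro y y' hy hy' z
    have e1 := hind z y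
    have e2 := hind z y'
    rw [hpair, lawX'] at e1 e2
    have e1' := mul_right_cancel₀ hy e1
    have e2' := mul_right_cancel₀ hy' e2
    rw [e1', e2']
  -- Step 4: the stabiliser subgroup of `μ`
  obtain ⟨H, hHmem⟩ : ∃ H : AddSubgroup G, ∀ h, h ∈ H ↔ ∀ x, μ (x + h) = μ x :=
    ⟨{ carrier := {h | ∀ x, μ (x + h) = μ x}
       zero_mem' := fun x => by rw [add_zero]
       add_mem' := fun {a b} ha hb x => by rw [← add_assoc, hb, ha]
       neg_mem' := fun {a} ha x => by rw [neg_char2]; exact ha x }, fun h => Iff.rfl⟩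
  obtain ⟨x₀, hx₀⟩ : ∃ x, μ x ≠ 0 := by
    by_contra hne
    have h0 : ∀ x, μ x = 0 := fun x => by_contra fun hx => hne ⟨x, hx⟩
    have : mass (univ : Finset G) μ = 0 := sum_eq_zero fun x _ => h0 x
    rw [hm1] at this
    exact one_ne_zero this
  have hdiff : ∀ y y', μ y ≠ 0 → μ y' ≠ 0 → y + y' ∈ H := by
    intro y y' hy hy'
    rw [hHmem]
    intro x
    calc μ (x + (y + y')) = μ ((x + y') + y) := by congr 1; abel
      _ = μ ((x + y') + y') := htrans y y' hy hy' (x + y')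
      _ = μ x := by rw [add_add_cancel_right_char2]
  have hval : ∀ x, μ x = if x + x₀ ∈ H then μ x₀ else 0 := by
    intro x
    split_ifs with hx
    · have := (hHmem _).1 hx x₀
      rwa [add_comm x, add_add_cancel_char2] at this
    · by_contra hne
      exact hx (hdiff x x₀ hne hx₀)
  -- Step 5: the uniform law on `T = H` and the computation `d[μ ; U_H] = 0`
  obtain ⟨T, hTmem⟩ : ∃ T : Finset G, ∀ x, x ∈ T ↔ x ∈ H :=
    ⟨univ.filter (· ∈ H), fun x => by rw [mem_filter]; exact ⟨fun h => h.2, fun h => ⟨mem_univ _, h⟩⟩⟩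
  have hTfil : univ.filter (· ∈ H) = T := by
    ext x; rw [mem_filter, hTmem]; exact ⟨fun h => h.2, fun h => ⟨mem_univ _, h⟩⟩
  have h0T : (0 : G) ∈ T := (hTmem 0).2 H.zero_mem
  have hTpos : (0 : ℝ) < T.card := by exact_mod_cast card_pos.2 ⟨0, h0T⟩
  refine ⟨H, T, hTmem, ?_⟩
  set U : G → ℝ := prob T (fun _ => (1 : ℝ)) id with hUdef
  have hU : ∀ x, U x = if x ∈ H then (T.card : ℝ)⁻¹ else 0 := by
    intro x
    rw [hUdef, prob_def, mass_def, mass_def, sum_const, sum_const, nsmul_eq_mul, nsmul_eq_mul,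
      mul_one, mul_one]
    split_ifs with hx
    · have : T.filter (fun i => id i = x) = {x} := by
        ext y; simp only [mem_filter, id_eq, mem_singleton, hTmem]
        exact ⟨fun h => h.2, fun h => ⟨h ▸ hx, h⟩⟩
      rw [this, card_singleton, Nat.cast_one, one_div]
    · have : T.filter (fun i => id i = x) = ∅ := by
        rw [filter_eq_empty_iff]
        intro y hy hyx
        rw [id_eq] at hyx
        exact hx (hyx ▸ (hTmem y).1 hy)
      rw [this, card_empty, Nat.cast_zero, zero_div]
  -- `μ - U_H = μ` in law
  have hsub : subLaw μ U = μ := by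
    funext z
    unfold subLaw
    simp_rw [hU, mul_ite, mul_zero]
    rw [← sum_filter]
    have : ∀ y ∈ univ.filter (· ∈ H), μ (z + y) * (T.card : ℝ)⁻¹ = μ z * (T.card : ℝ)⁻¹ := by
      intro y hy
      rw [(hHmem y).1 (mem_filter.1 hy).2 z]
    rw [sum_congr rfl this, sum_const, nsmul_eq_mul, hTfil]
    calc (T.card : ℝ) * (μ z * (T.card : ℝ)⁻¹) = μ z * ((T.card : ℝ) * (T.card : ℝ)⁻¹) := by ring
      _ = μ z := by rw [mul_inv_cancel₀ hTpos.ne', mul_one]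
  -- `H[U_H] = log |H|`
  have hentU : entFun U = Real.log T.card := by
    rw [hUdef, ← ent_eq_entFun]
    exact ent_eq_log_card_of_uniform one_pos (fun _ _ => rfl) (Set.injOn_id _)
  -- `∑ μ = 1` gives `|H| μ x₀ = 1`
  have hcμ : (T.card : ℝ) * μ x₀ = 1 := by
    have h1 : ∑ x, μ x = 1 := hμ.2
    rw [← Equiv.sum_comp (Equiv.addRight x₀)] at h1
    simp only [Equiv.coe_addRight] at h1
    rw [Fintype.sum_congr _ _ fun x => hval (x + x₀)] at h1
    simp_rw [add_add_cancel_right_char2] at h1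
    rw [← sum_filter, sum_const, nsmul_eq_mul, hTfil] at h1
    exact h1
  -- `H[μ] = log |H|`
  have hentμ : entFun μ = Real.log T.card := by
    unfold entFun
    rw [← Equiv.sum_comp (Equiv.addRight x₀)]
    simp only [Equiv.coe_addRight]
    rw [Fintype.sum_congr _ _ fun x => by rw [hval (x + x₀)]]
    simp_rw [add_add_cancel_right_char2, apply_ite negMulLog, negMulLog_zero]
    rw [← sum_filter, sum_const, nsmul_eq_mul, hTfil]
    have hx0 : μ x₀ = (T.card : ℝ)⁻¹ := eq_inv_of_mul_eq_one_right hcμ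
    rw [hx0, negMulLog, Real.log_inv, neg_mul_neg, ← mul_assoc, mul_inv_cancel₀ hTpos.ne', one_mul]
  rw [rdist_univ_id hμ, ← hUdef, dLaw, hsub, hentU, hentμ]
  ring

/-- **GGMT Lemma 2.2**: if `d[μ₁ ; μ₂] = 0` then there is a subgroup `H ≤ G` with
`d[μ₁ ; U_H] = d[μ₂ ; U_H] = 0`. [cite: GowersEtAl2025, Lemma 2.2] -/
theorem exists_subgroup_of_dLaw_eq_zero {μ₁ μ₂ : G → ℝ} (h₁ : μ₁ ∈ stdSimplex ℝ G)
    (h₂ : μ₂ ∈ stdSimplex ℝ G) (h : dLaw μ₁ μ₂ = 0) :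
    ∃ (H : AddSubgroup G) (T : Finset G), (∀ x, x ∈ T ↔ x ∈ H) ∧
      rdist univ μ₁ id T (fun _ => (1 : ℝ)) id = 0 ∧ rdist univ μ₂ id T (fun _ => (1 : ℝ)) id = 0 := by
  have hw₁ := stdSimplex_nonneg h₁
  have hw₂ := stdSimplex_nonneg h₂
  have hs₁ := mass_univ_pos_of_mem_stdSimplex h₁
  have hs₂ := mass_univ_pos_of_mem_stdSimplex h₂
  have h12 : rdist univ μ₁ id univ μ₂ id = 0 := by
    rw [rdist_univ_id h₁, funext (prob_univ_id h₂.2), h]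
  -- `d[μ₁ ; μ₁] = 0` by the triangle inequality
  have h11 : dLaw μ₁ μ₁ = 0 := by
    have t := rdist_triangle (id : G → G) (id : G → G) (id : G → G) hw₁ hs₁ hw₂ hs₂ hw₁ hs₁
    rw [h12, rdist_comm univ μ₂ id univ μ₁ id, h12, add_zero] at t
    have n := rdist_nonneg (id : G → G) (id : G → G) hw₁ hs₁ hw₁ hs₁
    have e : rdist univ μ₁ id univ μ₁ id = dLaw μ₁ μ₁ := by
      rw [rdist_univ_id h₁, funext (prob_univ_id h₁.2)]
    linarith
  obtain ⟨H, T, hT, hd⟩ := exists_subgroup_rdist_uniform_eq_zero h₁ h11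
  refine ⟨H, T, hT, hd, ?_⟩
  have hTne : T.Nonempty := ⟨0, (hT 0).2 H.zero_mem⟩
  have hwT : ∀ x ∈ T, (0 : ℝ) ≤ (fun _ => (1 : ℝ)) x := fun _ _ => zero_le_one
  have hsT : 0 < mass T (fun _ => (1 : ℝ)) := mass_pos (fun _ _ => one_pos) hTne
  have t := rdist_triangle (id : G → G) (id : G → G) (id : G → G) hw₂ hs₂ hw₁ hs₁ hwT hsT
  rw [rdist_comm univ μ₂ id univ μ₁ id, h12, hd, add_zero] at t
  have n := rdist_nonneg (id : G → G) (id : G → G) hw₂ hs₂ hwT hsT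
  linarith

end HundredPercent

end EntropicRuzsa

end Literature.Combinatorics.Additive

end
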